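import Summits.AtomisticToContinuum.BoseEinsteinCondensation.Theses.BECInsertionCorrector
import Summits.AtomisticToContinuum.BoseEinsteinCondensation.Theorems.StaticResponseBound.Negative.Basic
import Literature.MathematicalPhysics.QuantumManyBody.WeightedCorrector
import Literature.MathematicalPhysics.QuantumManyBody.LangevinGenerator
import Literature.MathematicalPhysics.QuantumManyBody.PeriodicBoseGasScatteringODE
import Mathlib.Analysis.InnerProductSpace.Calculus
import Mathlib.Analysis.Calculus.LocalExtr.Basic
import Mathlib.Analysis.SpecialFunctions.Trigonometric.Deriv
import Mathlib.Algebra.QuadraticDiscriminant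
import HarnessLib

/-!
# Thomson's principle for the density wave: `‖V_p − V̄‖²₋₁ ≤ (√N + ‖Q − Q̄‖₋₁)² / |p|²`

Stub `stub_thomsonReduction` of line `uv-thomson-force-wave` (crux
`BECInsertionCorrector.StaticResponseBound`, item stmt-AtomisticToContinuum-12057).

For a periodic trial state `Φ` on the torus of side `L > 0` (weight `W = |Φ|²`, `∫_cell W = 1`, complex
values and zeros allowed) and `k ≠ 0`, `p = 2πk/L`, write `θⱼ(X) = p·xⱼ`, `V = ∑ⱼ cos θⱼ` (density
wave), `p̂ = k/|k|`, `Yⱼ = sin θⱼ · p̂` (free displacement flow), `Q = (∑ⱼ sin θⱼ p̂·∇ⱼW)/W` (force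
wave; junk `0/0 = 0` at zeros of `W`). We prove: if `‖Q − Q̄‖²₋₁ ≤ B` for the weighted Dirichlet form
`𝓔(φ) = ∫ |∇φ|² W` (Kipnis–Varadhan norm, [KipnisLandim1999, App. 1 §6 (6.1)]), then
`‖V − V̄‖²₋₁ ≤ (√N + √B)²/|p|²` — Thomson's / minimal-flow principle [LyonsPeres2016, §2.4] with the
free flow `Y`. Proof: for a periodic test `φ`, integrating the `C¹` periodic fluxes `sin θⱼ · φ W` by
parts along `e_{j,c}` (`integral_cellN_pderiv_eq_zero`) gives `|p| ∫ V φ W = −∫ (Y·∇φ) W − ∫ Q φ W`,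
using the junk-free identity `Q W = Y·∇W` (at a zero of `W ≥ 0`, `∇W = 0` by Fermat); with `φ ≡ 1`,
`Q̄ = −|p| V̄`; so `|p| ∫ (V − V̄) φ W = −∫ (Y·∇φ) W − ∫ (Q − Q̄) φ W`, where `(∫ (Y·∇φ) W)² ≤ N 𝓔(φ)`
(Cauchy–Schwarz via a discriminant: `∑ⱼ sin² θⱼ ≤ N`, `|p̂| = 1`, `∫ W = 1`) and
`(∫ (Q − Q̄) φ W)² ≤ B 𝓔(φ)` (`hMinusOneSqW_le_ofReal_iff`). Everything is proved for a general `C¹`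
lattice-periodic weight `W ≥ 0`, an abstract phase `θ` (hypothesis `hθ`) and unit vector `u = p̂`
(`thomson_core`), and specialised to `W = |Φ|²` at the end.
-/

noncomputable section

namespace Summit.AtomisticToContinuum.BoseEinsteinCondensation.Cruxes.StaticResponseBound.UvThomsonForceWave

open MeasureTheory Filter Literature.MathematicalPhysics.QuantumManyBody.BoseGas
open Summit.AtomisticToContinuum.BoseEinsteinCondensation.Theses.BECInsertionCorrector
open Summit.AtomisticToContinuum.BoseEinsteinCondensation.Theorems.StaticResponseBound.Negative
open scoped ENNReal NNReal BigOperators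

section Thomson

variable {N : ℕ} {L : ℝ} {k : Fin 3 → ℤ} {θ : Fin N → Config N → ℝ} {u : Fin 3 → ℝ}

/-- `k ≠ 0` gives `∑ kₗ² > 0`. [folklore] -/
theorem thomson_sum_sq_pos (hk : k ≠ 0) : 0 < ∑ l, (k l : ℝ) ^ 2 := by
  obtain ⟨i, hi⟩ := Function.ne_iff.1 hk
  have hi' : (k i : ℝ) ≠ 0 := by exact_mod_cast hi
  exact lt_of_lt_of_le (by positivity)
    (Finset.single_le_sum (fun l _ => sq_nonneg ((k l : ℝ))) (Finset.mem_univ i))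

/-- `|p̂|² = 1` for `p̂ = k/|k|`, `k ≠ 0`. [folklore] -/
theorem thomson_sum_kh_sq (hk : k ≠ 0) :
    ∑ c, ((k c : ℝ) / Real.sqrt (∑ l, (k l : ℝ) ^ 2)) ^ 2 = 1 := by
  have hK := thomson_sum_sq_pos hk
  simp_rw [div_pow, Real.sq_sqrt hK.le]
  rw [← Finset.sum_div, div_self hK.ne']

/-- `p̂·p = |p| = √psq`: `∑_c (k_c/|k|) (2π k_c/L) = √((2π/L)² ∑ k_c²)` for `L > 0`. [folklore] -/
theorem thomson_sum_kh_mul (hL : 0 < L) (hk : k ≠ 0) :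
    ∑ c, (k c : ℝ) / Real.sqrt (∑ l, (k l : ℝ) ^ 2) * (2 * Real.pi / L * k c) = Real.sqrt (psq L k) := by
  have hK := thomson_sum_sq_pos hk
  calc ∑ c, (k c : ℝ) / Real.sqrt (∑ l, (k l : ℝ) ^ 2) * (2 * Real.pi / L * k c)
      = 2 * Real.pi / L * ((∑ c, (k c : ℝ) ^ 2) / Real.sqrt (∑ l, (k l : ℝ) ^ 2)) := by
        rw [Finset.sum_div, Finset.mul_sum]
        exact Finset.sum_congr rfl fun c _ => by ring
    _ = Real.sqrt (psq L k) := by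
        rw [Real.div_sqrt, psq, Real.sqrt_mul (sq_nonneg _), Real.sqrt_sq (by positivity)]

/-- **Fermat**: at a zero of a function `W ≥ 0` (a global minimum) all partial derivatives vanish
(Mathlib's convention `fderiv = 0` covers the non-differentiable case). [folklore] -/
theorem thomson_pderiv_eq_zero_of_nonneg {W : Config N → ℝ} (hW0 : ∀ Y, 0 ≤ W Y) {X : Config N}
    (hX : W X = 0) (j : Fin N) (c : Fin 3) : pderiv j c W X = 0 := by
  have hmin : IsLocalMin W X := Filter.Eventually.of_forall fun Y => by rw [hX]; exact hW0 Y
  rw [pderiv, hmin.fderiv_eq_zero]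
  rfl

/-- **The force wave times the weight is the flow derivative of the weight, everywhere**:
`Q W = Y·∇W` for `Q = (Y·∇W)/W`, `(Y·∇W)(X) = ∑ⱼ sin θⱼ(X) ∑ᵢ uᵢ ∂_{j,i}W(X)` (junk value `0` at zeros
of `W ≥ 0`, where `∇W = 0`). [folklore] -/
theorem thomson_forceWave_mul_weight {W : Config N → ℝ} (hW0 : ∀ Y, 0 ≤ W Y) (X : Config N) :
    (∑ j, Real.sin (θ j X) * ∑ i, u i * pderiv j i W X) / W X * W X =
      ∑ j, Real.sin (θ j X) * ∑ i, u i * pderiv j i W X := by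
  by_cases h : W X = 0
  · simp [h, thomson_pderiv_eq_zero_of_nonneg hW0 h]
  · exact div_mul_cancel₀ _ h

/-- The completed square behind `2 t sinθ (u·a) ≤ t²|a|² + 1` (`|u| = 1`, `sin² ≤ 1`). [folklore] -/
theorem thomson_completed_square (t s a₀ a₁ a₂ u₀ u₁ u₂ : ℝ) (hs : s ^ 2 ≤ 1)
    (hu : u₀ ^ 2 + u₁ ^ 2 + u₂ ^ 2 = 1) :
    0 ≤ t * t * (a₀ * a₀ + a₁ * a₁ + a₂ * a₂) - 2 * t * (s * (u₀ * a₀ + u₁ * a₁ + u₂ * a₂)) + 1 := by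
  have h1 : s ^ 2 * (u₀ ^ 2 + u₁ ^ 2 + u₂ ^ 2) = s ^ 2 := by rw [hu, mul_one]
  nlinarith [sq_nonneg (t * a₀ - s * u₀), sq_nonneg (t * a₁ - s * u₁), sq_nonneg (t * a₂ - s * u₂)]

/-- The final real-variable step: `S T = −y − D`, `y² ≤ n E`, `D² ≤ B E` give
`T² ≤ ((√n + √B)²/S²) E`. [folklore] -/
theorem thomson_sq_le {S T y D E n B : ℝ} (hS : 0 < S) (hn : 0 ≤ n) (hB : 0 ≤ B) (hE : 0 ≤ E)
    (hrel : S * T = -y - D) (hy : y ^ 2 ≤ n * E) (hD : D ^ 2 ≤ B * E) :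
    T ^ 2 ≤ (Real.sqrt n + Real.sqrt B) ^ 2 / S ^ 2 * E := by
  have h1 : |y| ≤ Real.sqrt n * Real.sqrt E := by rw [← Real.sqrt_mul hn]; exact Real.abs_le_sqrt hy
  have h2 : |D| ≤ Real.sqrt B * Real.sqrt E := by rw [← Real.sqrt_mul hB]; exact Real.abs_le_sqrt hD
  have h3 : |S * T| ≤ (Real.sqrt n + Real.sqrt B) * Real.sqrt E := by
    rw [hrel, show -y - D = -(y + D) by ring, abs_neg]
    calc |y + D| ≤ |y| + |D| := abs_add_le y D
      _ ≤ _ := by linarith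
  have h4 := pow_le_pow_left₀ (abs_nonneg _) h3 2
  rw [sq_abs, mul_pow _ (Real.sqrt E), Real.sq_sqrt hE] at h4
  rw [div_mul_eq_mul_div, le_div_iff₀ (by positivity : 0 < S ^ 2)]
  calc T ^ 2 * S ^ 2 = (S * T) ^ 2 := by ring
    _ ≤ (Real.sqrt n + Real.sqrt B) ^ 2 * E := h4

/-! From here on `θ j X` is the phase `θⱼ(X) = (2π/L) k·xⱼ` (hypothesis `hθ`), `u` plays the unit vector
`p̂` (`hu₁ : u·p = √psq`, `hu₂ : |u|² = 1`), the flow pairing is `(Y·∇f)(X) = ∑ⱼ sin θⱼ(X) ∑ᵢ uᵢ ∂_{j,i}f`. -/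

variable (hθ : ∀ (j : Fin N) (X : Config N), θ j X = 2 * Real.pi / L * ∑ i, (k i : ℝ) * X j i)
include hθ

/-- The phase `θⱼ` is a continuous linear functional of the configuration. [folklore] -/
theorem thomson_theta_clm (j : Fin N) : ∃ A : Config N →L[ℝ] ℝ, ∀ X : Config N, A X = θ j X :=
  ⟨(2 * Real.pi / L) • ∑ i : Fin 3, (k i : ℝ) •
      ((PiLp.proj 2 (fun _ : Fin 3 => ℝ) i).comp (ContinuousLinearMap.proj j : Config N →L[ℝ] Space)),
    fun X => by rw [hθ]; simp [Finset.mul_sum]⟩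

/-- `θⱼ` is continuous. [folklore] -/
theorem thomson_continuous_theta (j : Fin N) : Continuous (θ j) := by
  obtain ⟨A, hA⟩ := thomson_theta_clm hθ j
  exact A.continuous.congr hA

/-- `sin θⱼ` is `C¹`. [folklore] -/
theorem thomson_contDiff_sin_theta (j : Fin N) : ContDiff ℝ 1 fun X : Config N => Real.sin (θ j X) := by
  obtain ⟨A, hA⟩ := thomson_theta_clm hθ j
  have h : (fun X : Config N => Real.sin (θ j X)) = fun X => Real.sin (A X) := by simp only [hA]
  rw [h]
  exact Real.contDiff_sin.comp A.contDiff

/-- `∂_{j,c} sin θⱼ = p_c cos θⱼ`, `p_c = 2π k_c / L` (and `sin θⱼ` is differentiable). [folklore] -/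
theorem thomson_pderiv_sin_theta (j : Fin N) (c : Fin 3) (X : Config N) :
    DifferentiableAt ℝ (fun Y : Config N => Real.sin (θ j Y)) X ∧
      pderiv j c (fun Y : Config N => Real.sin (θ j Y)) X = 2 * Real.pi / L * k c * Real.cos (θ j X) := by
  obtain ⟨A, hA⟩ := thomson_theta_clm hθ j
  have h : HasFDerivAt (fun Y => Real.sin (A Y)) (Real.cos (A X) • A) X :=
    (Real.hasDerivAt_sin (A X)).comp_hasFDerivAt X A.hasFDerivAt
  simp only [hA] at h
  refine ⟨h.differentiableAt, ?_⟩
  have hθ1 : θ j (Pi.single j (EuclideanSpace.single c (1 : ℝ))) = 2 * Real.pi / L * k c := by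
    rw [hθ]; congr 1; simp [Finset.sum_ite_eq']
  rw [pderiv, h.fderiv, smul_apply, hA, smul_eq_mul, hθ1]
  ring

/-- `θⱼ(X + L e_{i,c}) = θⱼ(X) + 2π m` with `m = k_c [i = j] ∈ ℤ`. [folklore] -/
theorem thomson_theta_add_single (hL : L ≠ 0) (j i : Fin N) (c : Fin 3) (X : Config N) :
    ∃ m : ℤ, θ j (X + Pi.single i (EuclideanSpace.single c L)) = θ j X + m * (2 * Real.pi) := by
  rw [hθ, hθ]
  by_cases hij : i = j
  · rw [hij]
    refine ⟨k c, ?_⟩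
    have aux : 2 * Real.pi / L * ((k c : ℝ) * L) = (k c : ℝ) * (2 * Real.pi) := by field_simp
    simp only [Pi.add_apply, Pi.single_eq_same, PiLp.add_apply, PiLp.single_apply, mul_add,
      mul_ite, mul_zero, Finset.sum_add_distrib, Finset.sum_ite_eq', Finset.mem_univ, if_true,
      aux]
  · refine ⟨0, ?_⟩
    simp only [Pi.add_apply, Pi.single_eq_of_ne (Ne.symm hij), add_zero, Int.cast_zero, zero_mul]

/-- `sin θⱼ` is `Lℤ³`-periodic in every particle (`θⱼ` shifts by `2π k_c ∈ 2πℤ`). [folklore] -/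
theorem thomson_sin_theta_periodic (hL : L ≠ 0) (j : Fin N) :
    IsLatticePeriodic L (fun Y : Config N => Real.sin (θ j Y)) := by
  intro X i c
  obtain ⟨m, hm⟩ := thomson_theta_add_single hθ hL j i c X
  simp only [hm, Real.sin_add_int_mul_two_pi]

/-- Continuity of the flow pairing `X ↦ ∑ⱼ sin θⱼ ∑ᵢ uᵢ ∂_{j,i}f` for `f ∈ C¹`. [folklore] -/
theorem thomson_continuous_flow {f : Config N → ℝ} (hf : ContDiff ℝ 1 f) :
    Continuous fun X : Config N => ∑ j, Real.sin (θ j X) * ∑ i, u i * pderiv j i f X :=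
  continuous_finsetSum _ fun j _ =>
    (Real.continuous_sin.comp (thomson_continuous_theta hθ j)).mul
      (continuous_finsetSum _ fun i _ => continuous_const.mul (continuous_pderiv hf j i))

/-- Continuity of the density wave `V = ∑ⱼ cos θⱼ`. [folklore] -/
theorem thomson_continuous_cosSum : Continuous fun X : Config N => ∑ j, Real.cos (θ j X) :=
  continuous_finsetSum _ fun j _ => Real.continuous_cos.comp (thomson_continuous_theta hθ j)

/-- **The per-`(j,c)` flux identity.** For a `C¹` lattice-periodic weight `W`, a periodic test `φ` and
`L > 0`, the flux `G = sin θⱼ · φ W` is `C¹` periodic, and `∂_{j,c} G = p_c cos θⱼ φ W +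
sin θⱼ (φ ∂_{j,c}W + W ∂_{j,c}φ)` is integrable on the cell with integral `0`. [folklore] -/
theorem thomson_flux (hL : 0 < L) {W φ : Config N → ℝ} (hW : ContDiff ℝ 1 W)
    (hWp : IsLatticePeriodic L W) (hφ : IsPeriodicTest L φ) (j : Fin N) (c : Fin 3) :
    Integrable (fun X => 2 * Real.pi / L * k c * Real.cos (θ j X) * (φ X * W X) +
        Real.sin (θ j X) * (φ X * pderiv j c W X + W X * pderiv j c φ X))
        (volume.restrict (cellN N L)) ∧
      ∫ X in cellN N L, (2 * Real.pi / L * k c * Real.cos (θ j X) * (φ X * W X) +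
        Real.sin (θ j X) * (φ X * pderiv j c W X + W X * pderiv j c φ X)) = 0 := by
  have hG : ContDiff ℝ 1 fun Y : Config N => Real.sin (θ j Y) * (φ Y * W Y) :=
    (thomson_contDiff_sin_theta hθ j).mul (hφ.contDiff.mul hW)
  have hGp : IsLatticePeriodic L fun Y : Config N => Real.sin (θ j Y) * (φ Y * W Y) :=
    (thomson_sin_theta_periodic hθ hL.ne' j).mul (hφ.isLatticePeriodic.mul hWp)
  have hd : (fun X => 2 * Real.pi / L * k c * Real.cos (θ j X) * (φ X * W X) +
      Real.sin (θ j X) * (φ X * pderiv j c W X + W X * pderiv j c φ X)) =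
      pderiv j c (fun Y : Config N => Real.sin (θ j Y) * (φ Y * W Y)) := by
    funext X
    have hφd := hφ.differentiable X
    have hWd := hW.differentiable one_ne_zero X
    have hφW : DifferentiableAt ℝ (fun Y => φ Y * W Y) X := hφd.mul hWd
    obtain ⟨hsd, hs⟩ := thomson_pderiv_sin_theta hθ j c X
    rw [pderiv_fun_mul hsd hφW, pderiv_fun_mul hφd hWd, hs]
    ring
  rw [hd]
  exact ⟨integrableOn_cellN (continuous_pderiv hG j c) L, integral_cellN_pderiv_eq_zero hL hG hGp j c⟩

/-- **Master identity** (the fluxes summed against `u`, `∑_c u_c p_c = K`): for every periodic test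
function `φ`, `K ∫ V φ W + ∫ (Y·∇φ) W + ∫ (Y·∇W) φ = 0`. [folklore] -/
theorem thomson_master (hL : 0 < L) {K : ℝ} (hu₁ : ∑ c, u c * (2 * Real.pi / L * k c) = K)
    {W φ : Config N → ℝ} (hW : ContDiff ℝ 1 W) (hWp : IsLatticePeriodic L W) (hφ : IsPeriodicTest L φ) :
    K * (∫ X in cellN N L, (∑ j, Real.cos (θ j X)) * φ X * W X)
      + (∫ X in cellN N L, (∑ j, Real.sin (θ j X) * ∑ i, u i * pderiv j i φ X) * W X)
      + ∫ X in cellN N L, (∑ j, Real.sin (θ j X) * ∑ i, u i * pderiv j i W X) * φ X = 0 := by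
  have hpt : ∀ X : Config N, K * ((∑ j, Real.cos (θ j X)) * φ X * W X) +
      (∑ j, Real.sin (θ j X) * ∑ i, u i * pderiv j i φ X) * W X +
      (∑ j, Real.sin (θ j X) * ∑ i, u i * pderiv j i W X) * φ X =
      ∑ j, ∑ c, u c * (2 * Real.pi / L * k c * Real.cos (θ j X) * (φ X * W X) +
        Real.sin (θ j X) * (φ X * pderiv j c W X + W X * pderiv j c φ X)) := by
    intro X
    have inner : ∀ j : Fin N,
        ∑ c, u c * (2 * Real.pi / L * k c * Real.cos (θ j X) * (φ X * W X) +
          Real.sin (θ j X) * (φ X * pderiv j c W X + W X * pderiv j c φ X)) =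
        K * (Real.cos (θ j X) * φ X * W X) +
          Real.sin (θ j X) * (∑ c, u c * pderiv j c φ X) * W X +
          Real.sin (θ j X) * (∑ c, u c * pderiv j c W X) * φ X := by
      intro j
      rw [← hu₁]
      simp only [Finset.sum_mul, Finset.mul_sum, ← Finset.sum_add_distrib]
      exact Finset.sum_congr rfl fun c _ => by ring
    rw [Finset.sum_congr rfl fun j _ => inner j]
    simp only [Finset.sum_add_distrib, Finset.mul_sum, Finset.sum_mul]
  have hi1 : Integrable (fun X => (∑ j, Real.cos (θ j X)) * φ X * W X) (volume.restrict (cellN N L)) :=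
    integrableOn_cellN (((thomson_continuous_cosSum hθ).mul hφ.continuous).mul hW.continuous) L
  have hi2 : Integrable (fun X => (∑ j, Real.sin (θ j X) * ∑ i, u i * pderiv j i φ X) * W X)
      (volume.restrict (cellN N L)) :=
    integrableOn_cellN ((thomson_continuous_flow hθ hφ.contDiff).mul hW.continuous) L
  have hi3 : Integrable (fun X => (∑ j, Real.sin (θ j X) * ∑ i, u i * pderiv j i W X) * φ X)
      (volume.restrict (cellN N L)) :=
    integrableOn_cellN ((thomson_continuous_flow hθ hW).mul hφ.continuous) L
  have h12 : Integrable (fun X => K * ((∑ j, Real.cos (θ j X)) * φ X * W X) +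
      (∑ j, Real.sin (θ j X) * ∑ i, u i * pderiv j i φ X) * W X) (volume.restrict (cellN N L)) :=
    (hi1.const_mul _).add hi2
  have hF := fun j c => thomson_flux hθ hL hW hWp hφ j c
  rw [← integral_const_mul, ← integral_add (hi1.const_mul _) hi2, ← integral_add h12 hi3,
    integral_congr_ae (Eventually.of_forall hpt),
    integral_finsetSum _ fun j _ => integrable_finsetSum _ fun c _ => (hF j c).1.const_mul _]
  refine Finset.sum_eq_zero fun j _ => ?_
  rw [integral_finsetSum _ fun c _ => (hF j c).1.const_mul _]
  refine Finset.sum_eq_zero fun c _ => ?_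
  rw [integral_const_mul, (hF j c).2, mul_zero]

/-- **Cauchy–Schwarz for the free displacement flow**: `(∫ (Y·∇φ) W)² ≤ N (∫ W) 𝓔(φ)` for a
continuous weight `W ≥ 0` (`∑ⱼ sin² θⱼ ≤ N`, `|u| = 1`; via the discriminant of
`t ↦ ∫ ∑ⱼ |t∇ⱼφ − sin θⱼ u|² W ≥ 0`). [folklore] -/
theorem thomson_flow_pairing_sq_le (hu₂ : u 0 ^ 2 + u 1 ^ 2 + u 2 ^ 2 = 1) {W φ : Config N → ℝ}
    (hWc : Continuous W) (hW0 : ∀ X, 0 ≤ W X) (hφ : ContDiff ℝ 1 φ) :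
    (∫ X in cellN N L, (∑ j, Real.sin (θ j X) * ∑ i, u i * pderiv j i φ X) * W X) ^ 2 ≤
      (N * ∫ X in cellN N L, W X) * ∫ X in cellN N L, gradDot φ φ X * W X := by
  have hpt : ∀ (t : ℝ) (X : Config N), 0 ≤ t * t * (gradDot φ φ X * W X) -
      2 * t * ((∑ j, Real.sin (θ j X) * ∑ i, u i * pderiv j i φ X) * W X) + N * W X := by
    intro t X
    have hj : ∀ j : Fin N, 0 ≤ t * t * (∑ c, pderiv j c φ X * pderiv j c φ X) -
        2 * t * (Real.sin (θ j X) * ∑ c, u c * pderiv j c φ X) + 1 := by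
      intro j
      have h := thomson_completed_square t (Real.sin (θ j X)) (pderiv j 0 φ X) (pderiv j 1 φ X)
        (pderiv j 2 φ X) (u 0) (u 1) (u 2) (Real.sin_sq_le_one _) hu₂
      simpa only [Fin.sum_univ_three] using h
    have hX : 0 ≤ t * t * gradDot φ φ X -
        2 * t * (∑ j, Real.sin (θ j X) * ∑ i, u i * pderiv j i φ X) + N := by
      calc (0 : ℝ) ≤ ∑ j : Fin N, (t * t * (∑ c, pderiv j c φ X * pderiv j c φ X) -
            2 * t * (Real.sin (θ j X) * ∑ c, u c * pderiv j c φ X) + 1) :=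
            Finset.sum_nonneg fun j _ => hj j
        _ = _ := by
            simp only [Finset.sum_add_distrib, Finset.sum_sub_distrib, ← Finset.mul_sum,
              Finset.sum_const, Finset.card_univ, Fintype.card_fin, nsmul_eq_mul, mul_one, gradDot]
    calc (0 : ℝ) ≤ _ := mul_nonneg hX (hW0 X)
      _ = _ := by ring
  have hWi : Integrable (fun X => W X) (volume.restrict (cellN N L)) := integrableOn_cellN hWc L
  have hgi : Integrable (fun X => gradDot φ φ X * W X) (volume.restrict (cellN N L)) :=
    integrableOn_cellN ((continuous_gradDot hφ hφ).mul hWc) L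
  have hyi : Integrable (fun X => (∑ j, Real.sin (θ j X) * ∑ i, u i * pderiv j i φ X) * W X)
      (volume.restrict (cellN N L)) :=
    integrableOn_cellN ((thomson_continuous_flow hθ hφ).mul hWc) L
  have key : ∀ t : ℝ, 0 ≤ (∫ X in cellN N L, gradDot φ φ X * W X) * (t * t) +
      -(2 * ∫ X in cellN N L, (∑ j, Real.sin (θ j X) * ∑ i, u i * pderiv j i φ X) * W X) * t +
      N * ∫ X in cellN N L, W X := by
    intro t
    have h12 : Integrable (fun X => t * t * (gradDot φ φ X * W X) -
        2 * t * ((∑ j, Real.sin (θ j X) * ∑ i, u i * pderiv j i φ X) * W X))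
        (volume.restrict (cellN N L)) := (hgi.const_mul _).sub (hyi.const_mul _)
    have h0 : 0 ≤ ∫ X in cellN N L, (t * t * (gradDot φ φ X * W X) -
        2 * t * ((∑ j, Real.sin (θ j X) * ∑ i, u i * pderiv j i φ X) * W X) + N * W X) :=
      integral_nonneg (hpt t)
    rw [integral_add h12 (hWi.const_mul _), integral_sub (hgi.const_mul _) (hyi.const_mul _),
      integral_const_mul, integral_const_mul, integral_const_mul] at h0
    linarith
  have hd := discrim_le_zero key
  rw [discrim] at hd; nlinarith [hd]

/-- **Thomson's principle for a general weight.** For `L > 0`, `k ≠ 0`, a `C¹` lattice-periodic weight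
`W ≥ 0` with `∫_cell W = 1`, and `B ≥ 0`: if the centred force wave `Q − Q̄`, `Q = (Y·∇W)/W`, obeys
the Kipnis–Varadhan bound `(∫ (Q − Q̄) φ W)² ≤ B 𝓔(φ)` for all periodic test `φ`, then the centred
density wave obeys `(∫ (V − V̄) φ W)² ≤ ((√N + √B)²/|p|²) 𝓔(φ)`. [cite: KipnisLandim1999, App. 1 §6 (6.1)] -/
theorem thomson_core (hL : 0 < L) (hk : k ≠ 0)
    (hu₁ : ∑ c, u c * (2 * Real.pi / L * k c) = Real.sqrt (psq L k))
    (hu₂ : u 0 ^ 2 + u 1 ^ 2 + u 2 ^ 2 = 1) {W : Config N → ℝ} (hW : ContDiff ℝ 1 W)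
    (hWp : IsLatticePeriodic L W) (hW0 : ∀ X, 0 ≤ W X) (hW1 : ∫ X in cellN N L, W X = 1)
    {B : ℝ} (hB : 0 ≤ B)
    (hQ : ∀ φ : Config N → ℝ, IsPeriodicTest L φ →
      (∫ X in cellN N L, ((∑ j, Real.sin (θ j X) * ∑ i, u i * pderiv j i W X) / W X -
        ∫ Y in cellN N L, (∑ j, Real.sin (θ j Y) * ∑ i, u i * pderiv j i W Y) / W Y * W Y) *
          φ X * W X) ^ 2 ≤ B * ∫ X in cellN N L, gradDot φ φ X * W X)
    {φ : Config N → ℝ} (hφ : IsPeriodicTest L φ) :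
    (∫ X in cellN N L, ((∑ j, Real.cos (θ j X)) - ∫ Y in cellN N L, (∑ j, Real.cos (θ j Y)) * W Y) *
        φ X * W X) ^ 2 ≤
      (Real.sqrt N + Real.sqrt B) ^ 2 / psq L k * ∫ X in cellN N L, gradDot φ φ X * W X := by
  have hpsq : 0 < psq L k := by have := thomson_sum_sq_pos hk; unfold psq; positivity
  -- the master identity for `φ` and for `φ ≡ 1`; the junk-free identity removes the division
  have hm1 := thomson_master hθ hL hu₁ hW hWp hφ
  have hm0 := thomson_master hθ hL hu₁ hW hWp (IsPeriodicTest.const L 1)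
  simp only [mul_one, pderiv_const, mul_zero, Finset.sum_const_zero, zero_mul, integral_zero,
    add_zero] at hm0
  simp only [thomson_forceWave_mul_weight hW0] at hQ
  have hD := hQ φ hφ
  have hiφW : Integrable (fun X => φ X * W X) (volume.restrict (cellN N L)) :=
    integrableOn_cellN (hφ.continuous.mul hW.continuous) L
  have hiP : Integrable (fun X => (∑ j, Real.sin (θ j X) * ∑ i, u i * pderiv j i W X) * φ X)
      (volume.restrict (cellN N L)) :=
    integrableOn_cellN ((thomson_continuous_flow hθ hW).mul hφ.continuous) L
  have hiV : Integrable (fun X => (∑ j, Real.cos (θ j X)) * φ X * W X) (volume.restrict (cellN N L)) :=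
    integrableOn_cellN (((thomson_continuous_cosSum hθ).mul hφ.continuous).mul hW.continuous) L
  -- the two centred pairings: `∫ (Q − Q̄) φ W = q − Q̄ m`, `∫ (V − V̄) φ W = a − V̄ m`
  have hpair : ∫ X in cellN N L, ((∑ j, Real.sin (θ j X) * ∑ i, u i * pderiv j i W X) / W X -
      ∫ Y in cellN N L, ∑ j, Real.sin (θ j Y) * ∑ i, u i * pderiv j i W Y) * φ X * W X =
      (∫ X in cellN N L, (∑ j, Real.sin (θ j X) * ∑ i, u i * pderiv j i W X) * φ X) -
        (∫ Y in cellN N L, ∑ j, Real.sin (θ j Y) * ∑ i, u i * pderiv j i W Y) *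
          ∫ X in cellN N L, φ X * W X := by
    rw [← integral_const_mul, ← integral_sub hiP (hiφW.const_mul _)]
    exact integral_congr_ae (Eventually.of_forall fun X => by
      linear_combination (φ X) * thomson_forceWave_mul_weight (θ := θ) (u := u) hW0 X)
  have htarget : ∫ X in cellN N L, ((∑ j, Real.cos (θ j X)) -
      ∫ Y in cellN N L, (∑ j, Real.cos (θ j Y)) * W Y) * φ X * W X =
      (∫ X in cellN N L, (∑ j, Real.cos (θ j X)) * φ X * W X) -
        (∫ Y in cellN N L, (∑ j, Real.cos (θ j Y)) * W Y) * ∫ X in cellN N L, φ X * W X := by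
    rw [← integral_const_mul, ← integral_sub hiV (hiφW.const_mul _)]
    exact integral_congr_ae (Eventually.of_forall fun X => by ring)
  rw [htarget]; rw [hpair] at hD
  -- the cost of the free flow, and assembly: `√psq (a − V̄ m) = −y − (q − Q̄ m)`
  have hy := thomson_flow_pairing_sq_le (L := L) hθ hu₂ hW.continuous hW0 hφ.contDiff
  rw [hW1, mul_one] at hy
  have hE : 0 ≤ ∫ X in cellN N L, gradDot φ φ X * W X :=
    integral_nonneg fun X => mul_nonneg (gradDot_self_nonneg φ X) (hW0 X)
  rw [← Real.sq_sqrt hpsq.le]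
  exact thomson_sq_le (Real.sqrt_pos.2 hpsq) (Nat.cast_nonneg N) hB hE
    (by linear_combination hm1 - (∫ X in cellN N L, φ X * W X) * hm0) hy hD

end Thomson

/-- S4 (M, the lever, provable now): Thomson's principle — verbatim `ThomsonReduction` with
`forceWave`/`khat` unfolded: for `L > 0`, `k ≠ 0` and any periodic trial state `Φ`, if the centred
force-density wave `Q_Φ − Q̄` has `‖·‖²_{H₋₁(|Φ|²)} ≤ B` then the centred density wave
`∑ⱼ cos(p·xⱼ) − ⟨∑cos⟩_Φ` has `‖·‖²_{H₋₁(|Φ|²)} ≤ (√N + √B)²/|p|²` (minimal-flow / Thomson principle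
for the Kipnis–Varadhan `H₋₁` norm with the free displacement flow `Yⱼ = sin(p·xⱼ) p̂`; Lyons–Peres
§2.4). [cite: KipnisLandim1999, App. 1 §6 (6.1)] -/
theorem stub_thomsonReduction :
    ∀ (N : ℕ) (L : ℝ), 0 < L → ∀ (k : Fin 3 → ℤ), k ≠ 0 →
      ∀ (Φ : PeriodicTrialState N L) (B : ℝ), 0 ≤ B →
      hMinusOneSqW L (fun X => ‖Φ.ψ X‖)
          (fun X => ((∑ j : Fin N, Real.sin (2 * Real.pi / L * ∑ i, (k i : ℝ) * X j i) *
              ∑ i : Fin 3, ((k i : ℝ) / Real.sqrt (∑ l, (k l : ℝ) ^ 2)) *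
                pderiv j i (fun Y => ‖Φ.ψ Y‖ ^ 2) X) / ‖Φ.ψ X‖ ^ 2) -
            ∫ Y in cellN N L, ((∑ j : Fin N, Real.sin (2 * Real.pi / L * ∑ i, (k i : ℝ) * Y j i) *
              ∑ i : Fin 3, ((k i : ℝ) / Real.sqrt (∑ l, (k l : ℝ) ^ 2)) *
                pderiv j i (fun Y => ‖Φ.ψ Y‖ ^ 2) Y) / ‖Φ.ψ Y‖ ^ 2) * ‖Φ.ψ Y‖ ^ 2)
        ≤ ENNReal.ofReal B →
      hMinusOneSqW L (fun X => ‖Φ.ψ X‖)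
          (fun X => (∑ j, Real.cos (2 * Real.pi / L * ∑ i, (k i : ℝ) * X j i)) - cosMean L k Φ)
        ≤ ENNReal.ofReal ((Real.sqrt N + Real.sqrt B) ^ 2 / psq L k) := by
  intro N L hL k hk Φ B hB hQ
  have hC : 0 ≤ (Real.sqrt N + Real.sqrt B) ^ 2 / psq L k :=
    div_nonneg (sq_nonneg _) (psq_nonneg L k)
  rw [hMinusOneSqW_le_ofReal_iff hB] at hQ
  rw [hMinusOneSqW_le_ofReal_iff hC]
  intro φ hφ
  have hW : ContDiff ℝ 1 fun Y => ‖Φ.ψ Y‖ ^ 2 := Φ.contDiff.norm_sq ℝ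
  have hWp : IsLatticePeriodic L fun Y => ‖Φ.ψ Y‖ ^ 2 := fun X i c => by
    show ‖Φ.ψ (X + Pi.single i (EuclideanSpace.single c L))‖ ^ 2 = ‖Φ.ψ X‖ ^ 2
    rw [Φ.periodic]
  exact thomson_core (θ := fun j X => 2 * Real.pi / L * ∑ i, (k i : ℝ) * X j i) (fun _ _ => rfl) hL hk
    (thomson_sum_kh_mul hL hk) (by simpa only [Fin.sum_univ_three] using thomson_sum_kh_sq hk) hW hWp
    (fun X => sq_nonneg _) (integral_norm_sq_eq_one Φ) hB hQ hφ

end Summit.AtomisticToContinuum.BoseEinsteinCondensation.Cruxes.StaticResponseBound.UvThomsonForceWave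

end
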